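import Summits.AtomisticToContinuum.Crystallization.Theses.PhononSlackCertificates

/-!
# Route `PhononSlackCertificates`, item `AllBadGap` (stmt-AtomisticToContinuum-13960): the route-internal derivations

`AllBadGap` : for every `δ > 0` there is `g > 0` such that every `δ`-separated configuration
`x : Fin N → ℝ³` in which EVERY particle is `1/20`-bad (`¬ IsTwoShellGood (1/20) (47/50) 1 x i`)
has `N · (e* + g) ≤ 𝓔_LJ(x)`, `e* = ⨅_Q e(Q)` over periodic configurations.  It is a hypothesis of
the route's deciding theorem `closes` that the proof of `closes` never uses; this file shows it is
DERIVED from either of the route's energy cruxes, so that it closes mechanically with them: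

* `allBadGap_of_coerciveTwoShellGap` — `CoerciveTwoShellGap → AllBadGap` (`U =` all particles:
  the bad count is `N`); CONDITIONAL on the target stmt-13956.
* `allBadGap_of_farFieldGapR` — `FarFieldGapR → AllBadGap` (`U = univ` has empty `R`-boundary
  and `∑ᵢ (½ ∑_{j ≠ i} V − e*) = 𝓔 − N·e*`); CONDITIONAL on the crux stmt-14969.
* `not_isTwoShellGood_of_separated` — for `δ > 21/20` EVERY particle of a `δ`-separated
  configuration is bad (a good particle has another particle within `21a/20 ≤ 21/20`), so on that
  range the badness hypothesis is vacuous and the item is a plain energy bound for separated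
  matter.

The unconditional energy statements (the `g = 0` floor `N·e* ≤ 𝓔(x)` by periodisation + item
0714, and the dilute regime `δ ≥ 2` with explicit `g = 1/2 − (250/12)δ⁻⁶`, badness unused) are
the companion file `PhononSlackCertificatesAllBadGapFloor.lean`.  What is NOT provable now, and
is the whole content of the item: the uniform gap for `δ ≤ 1.035` (blocks of every close packing
at the optimal spacing `a' ≈ 0.971` are `δ`-separated there) — that Lennard-Jones matter with NO
`1/20`-fcc/hcp two-shell environment is uniformly worse per particle than the periodic infimum, a
quantitative piece of the 3-D Lennard-Jones crystallization problem (BlancLewin2015 §2.3, open);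
the route files it as kill criterion (i).
-/

noncomputable section

namespace Summit.AtomisticToContinuum.Crystallization.Theorems.PhononSlackCertificatesAllBadGap

open scoped BigOperators Classical
open Literature.MathematicalPhysics.StatisticalMechanics Literature.Geometry.DiscreteGeometry
open Summit.AtomisticToContinuum.Crystallization.Theses.PhononSlackCertificates
  (AllBadGap CoerciveTwoShellGap FarFieldGapR)

/-! ## Where badness is automatic: `δ > 21/20` -/

/-- Either two-shell pattern contains a first-shell point, of norm `1`. [folklore] -/
theorem exists_mem_norm_eq_one {P : Finset (EuclideanSpace ℝ (Fin 3))}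
    (hP : P = fccTwoShellPattern ∨ P = hcpTwoShellPattern) : ∃ v ∈ P, ‖v‖ = 1 := by
  rcases hP with rfl | rfl
  · obtain ⟨v, hv⟩ : fccKissingPattern.Nonempty :=
      Finset.card_pos.1 (by rw [card_fccKissingPattern]; norm_num)
    exact ⟨v, fccKissingPattern_subset hv, norm_eq_one_of_mem_fccKissingPattern hv⟩
  · obtain ⟨v, hv⟩ : hcpKissingPattern.Nonempty :=
      Finset.card_pos.1 (by rw [card_hcpKissingPattern]; norm_num)
    exact ⟨v, hcpKissingPattern_subset hv, norm_eq_one_of_mem_hcpKissingPattern hv⟩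

/-- **For `δ > 21/20` every particle of a `δ`-separated configuration is `1/20`-bad**: a good
particle `i` has another particle within `a/20` of a first-shell pattern point, hence within
`a + a/20 ≤ 21/20` of `x i`.  So on `δ > 21/20` the badness hypothesis of `AllBadGap` is vacuous and
the item is there the plain energy bound `N·(e* + g) ≤ 𝓔_LJ(x)` for `δ`-separated `x` (companion file
`…AllBadGapFloor` for `δ ≥ 2`; the range `21/20 < δ < 2` needs sharp packing/kissing bounds, the
range `δ ≤ 1` contains blocks of every close packing and is the open core). [folklore] -/
theorem not_isTwoShellGood_of_separated {N : ℕ} {x : Fin N → (EuclideanSpace ℝ (Fin 3))} {δ : ℝ} (hδ : 21 / 20 < δ)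
    (hsep : ∀ i j : Fin N, i ≠ j → δ ≤ dist (x i) (x j)) (i : Fin N) :
    ¬ IsTwoShellGood (1 / 20) (47 / 50) 1 x i := by
  rintro ⟨a, ha₁, ha₂, A, P, f, hP, hf, -, -⟩
  obtain ⟨v, hv, hv1⟩ := exists_mem_norm_eq_one hP
  obtain ⟨hne, hd⟩ := hf v hv
  have ha0 : 0 ≤ a := by linarith
  have hAv : dist (x i + a • A v) (x i) = a := by
    rw [dist_eq_norm, add_sub_cancel_left, norm_smul, A.norm_map, hv1, mul_one,
      Real.norm_of_nonneg ha0]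
  have h1 : dist (x (f v)) (x i) ≤ 1 / 20 * a + a := by
    calc dist (x (f v)) (x i)
        ≤ dist (x (f v)) (x i + a • A v) + dist (x i + a • A v) (x i) := dist_triangle _ _ _
      _ ≤ 1 / 20 * a + a := by rw [hAv]; exact add_le_add hd le_rfl
  have h2 : δ ≤ dist (x (f v)) (x i) := hsep _ _ hne
  linarith

/-! ## `AllBadGap` from the route's cruxes -/

/-- **`CoerciveTwoShellGap → AllBadGap`**: when every particle is bad the bad count is `N`, so the
coercive inequality `N·e* + g·#bad ≤ 𝓔` reads `N·(e* + g) ≤ 𝓔`. CONDITIONAL on the route's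
target `CoerciveTwoShellGap` (stmt-13956, open). [folklore] -/
theorem allBadGap_of_coerciveTwoShellGap (h : CoerciveTwoShellGap) : AllBadGap := by
  intro δ hδ
  obtain ⟨g, hg, hgap⟩ := h δ hδ
  refine ⟨g, hg, fun N x hsep hbad => ?_⟩
  have key := hgap N x hsep
  have hcard : (Nat.card {i : Fin N // ¬ IsTwoShellGood (1 / 20) (47 / 50) 1 x i} : ℝ) = N := by
    rw [Nat.card_congr (Equiv.subtypeUnivEquiv hbad), Nat.card_eq_fintype_card, Fintype.card_fin]
  rw [hcard] at key
  linarith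

/-- With `U =` all particles the sum of the excess site energies is `𝓔_LJ(x) − N·e*`
(double counting `2 𝓔 = ∑ᵢ ∑_{j ≠ i} V`). [folklore] -/
theorem sum_univ_half_site_sub {N : ℕ} (x : Fin N → (EuclideanSpace ℝ (Fin 3))) (e : ℝ) :
    ∑ i ∈ (Finset.univ : Finset (Fin N)),
        ((1 / 2 : ℝ) * (∑ j ∈ Finset.univ.erase i, lennardJones (dist (x i) (x j))) - e) =
      interactionEnergy lennardJones x - N * e := by
  have h2 := two_mul_interactionEnergy lennardJones x
  simp only [siteEnergy] at h2
  rw [Finset.sum_sub_distrib, ← Finset.mul_sum, ← h2, Finset.sum_const, Finset.card_univ,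
    Fintype.card_fin, nsmul_eq_mul]
  ring

/-- **`FarFieldGapR → AllBadGap`** (the `∂U = ∅` case): take `U =` all particles; its
`R`-boundary `{i ∈ U : ∃ j ∉ U, …}` is empty, and the far-field inequality
`g·N − C·0 ≤ ∑ᵢ (½ ∑_{j ≠ i} V − e*) = 𝓔 − N·e*` is `N·(e* + g) ≤ 𝓔`. CONDITIONAL on the route's
crux `FarFieldGapR` (stmt-14969, open). [folklore] -/
theorem allBadGap_of_farFieldGapR (h : FarFieldGapR) : AllBadGap := by
  intro δ hδ
  obtain ⟨g, hg, C, R, hfar⟩ := h δ hδ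
  refine ⟨g, hg, fun N x hsep hbad => ?_⟩
  have key := hfar N x hsep Finset.univ (fun i _ => hbad i)
  haveI : IsEmpty {i : Fin N // i ∈ (Finset.univ : Finset (Fin N)) ∧
      ∃ j : Fin N, j ∉ (Finset.univ : Finset (Fin N)) ∧ dist (x j) (x i) ≤ R} :=
    ⟨fun ⟨_, _, j, hj, _⟩ => hj (Finset.mem_univ j)⟩
  rw [Nat.card_of_isEmpty, sum_univ_half_site_sub, Finset.card_univ, Fintype.card_fin] at key
  push_cast at key
  linarith

end Summit.AtomisticToContinuum.Crystallization.Theorems.PhononSlackCertificatesAllBadGap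

end
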